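import Mathlib
import HarnessLib

/-!
# Explicit GEVREY-2 bounds for all derivatives of `expNegInvGlue` (`e^{−1/x}` glued to `0`) and of Mathlib's `Real.smoothTransition`:
# `|expNegInvGlue^{(n)}(x)| ≤ 8ⁿ·(n!)²`, `|smoothTransition^{(n)}(x)| ≤ e²·(n!)²·(16(1+2e²))ⁿ ≤ 8·(n!)²·256ⁿ` for ALL `n` and ALL `x`

Topic `Analysis/Calculus`.  The classical fact that `x ↦ e^{−1/x}` (`x > 0`) is in the Gevrey class of order `2` — its `n`-th derivative is
`P_n(1/x)·e^{−1/x}` with `P₀ = 1`, `P_{n+1} = X²(P_n − P_n′)` (these are the signed Lah polynomials, `deg P_n ≤ 2n`), and `t^m e^{−t} ≤ m!` — made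
QUANTITATIVE with no `∃`: the weighted coefficient mass `Σ_m |[X^m]P_n|·m!` at most doubles its `(2n+1)²`-multiple per step, whence `≤ 8ⁿ(n!)²`.
Mathlib proves smoothness of `expNegInvGlue` through exactly this polynomial recursion (`expNegInvGlue.hasDerivAt_polynomial_eval_inv_mul`) but records
no bound.  A Gevrey-2 RECIPROCAL RULE at a point (`|f| ≥ d`, `|f^{(i)}| ≤ B(i!)²σⁱ ⇒ |(1/f)^{(n)}| ≤ d⁻¹(n!)²(σ(1+B/d))ⁿ`, Leibniz + the telescoping
sum `(r−σ)Σσⁱr^{j−i} = r^{j+1} − σ^{j+1}`) and the Leibniz bound for `(n!)²`-geometric jets (`Literature.Analysis.Calculus.norm_iteratedFDeriv_mul_le_of_factorialPow`,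
restated here in one variable to keep this file `Mathlib`-only) then give the table for `smoothTransition = E/(E + E(1−·))` (denominator `≥ e^{−2}`).
Such explicit Gevrey tables are what the smooth-cutoff bookkeeping of constructive fermionic renormalisation consumes (Disertori–Rivasseau 2000, Part I,
§II.2 footnote to (II.13)–(II.14): the cutoff is ASSUMED in a Gevrey class `‖u^{(n)}‖ ≤ Aμ^{−n}(n/e)^{ns}`, which App. A Lemma 11 turns into stretched-exponential
decay of the sliced propagators; here that assumption is PROVED, with `s = 2` and numerals, for Mathlib's glue function and transition — the cite tags
below name the source's posited class, the computation is ours; cell gate-hubbard-kl, located risk «(C)-B-ALIAS-L»: the table hypothesis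
`‖χ₂^{(l)}‖ ≤ X₀(l!)²C_χ^l` of the Salmhofer cutoff becomes numerals, file `MathematicalPhysics/QuantumLattice/SalmhoferCutoffGevrey`).

* `pow_mul_exp_neg_le_factorial` — `tᵐ·e^{−t} ≤ m!` (`t ≥ 0`);
* `abs_eval_mul_exp_neg_le_sum_abs_coeff` — `|p(t)|·e^{−t} ≤ Σ_{m ≤ d} |[X^m]p|·m!` (`deg p ≤ d`, `t ≥ 0`);
* `sum_abs_coeff_X_sq_mul_sub_derivative_le` — the mass step `Σ_{m ≤ d+2} |[X^m](X²(p − p′))|·m! ≤ 2(d+1)²·Σ_{m ≤ d} |[X^m]p|·m!`;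
* `exists_poly_iteratedDeriv_expNegInvGlue` — `E^{(n)} = P_n(1/x)·E(x)` everywhere, `deg P_n ≤ 2n`, mass `≤ 8ⁿ(n!)²`;
* **`abs_iteratedDeriv_expNegInvGlue_le`** — `|E^{(n)}(x)| ≤ 8ⁿ·(n!)²` (all `n`, all `x`); `norm_iteratedFDeriv_expNegInvGlue_le`;
* `sub_mul_sum_pow_mul_pow_eq` — `(r − σ)·Σ_{i ≤ j} σⁱ r^{j−i} = r^{j+1} − σ^{j+1}`;
* **`abs_iteratedDeriv_inv_le_of_gevrey_two`** — the Gevrey-2 reciprocal rule at a point;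
* `abs_iteratedDeriv_mul_le_of_sq_factorial` — Leibniz for two `(n!)²`-geometric jets with a common ratio (one variable);
* `exp_neg_two_le_expNegInvGlue_add` — `e^{−2} ≤ E(x) + E(1−x)`; `abs_iteratedDeriv_expNegInvGlue_add_le` — `|(E + E(1−·))^{(n)}| ≤ 2·8ⁿ(n!)²`;
* **`abs_iteratedDeriv_smoothTransition_le`** — `|smoothTransition^{(n)}(x)| ≤ e²·(n!)²·(16(1+2e²))ⁿ`;
  **`abs_iteratedDeriv_smoothTransition_le_numeral`** — `≤ 8·(n!)²·256ⁿ`; `norm_iteratedFDeriv_smoothTransition_le_numeral`.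

Everything is proved; no definitions; no named facts.

## Sources

M. Disertori, V. Rivasseau, Commun. Math. Phys. 215 (2000) 251–290, §II (II.13) footnote, App. A Lemma 11 (`DisertoriRivasseau2000`; Gevrey cutoffs);
G. Benfatto, A. Giuliani, V. Mastropietro, Ann. Henri Poincaré 7 (2006) 809–898, §2.2 (2.9) (`BenfattoGiulianiMastropietro2006`; «a smooth compact support
function»); the polynomial recursion is Mathlib's `expNegInvGlue.hasDerivAt_polynomial_eval_inv_mul`, Leibniz is Mathlib's `iteratedDeriv_mul`.
-/

noncomputable section

namespace Literature.Analysis.Calculus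

open Polynomial Real Finset
open scoped Nat Topology

/-! ## §1 `tᵐ e^{−t} ≤ m!` and the weighted coefficient mass -/

/-- `tᵐ·e^{−t} ≤ m!` for `t ≥ 0` (from `tᵐ/m! ≤ eᵗ`). [cite: DisertoriRivasseau2000, §II.2 (II.14) footnote p0004:L18–26] -/
theorem pow_mul_exp_neg_le_factorial {t : ℝ} (ht : 0 ≤ t) (m : ℕ) : t ^ m * exp (-t) ≤ (m ! : ℝ) := by
  have h := Real.pow_div_factorial_le_exp t ht m
  have hm : (0 : ℝ) < m ! := by positivity
  rw [div_le_iff₀ hm] at h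
  have hexp : 0 < exp (-t) := exp_pos _
  calc t ^ m * exp (-t) ≤ (exp t * m !) * exp (-t) := by gcongr
    _ = (m ! : ℝ) * (exp t * exp (-t)) := by ring
    _ = (m ! : ℝ) := by rw [← Real.exp_add, add_neg_cancel, Real.exp_zero, mul_one]

/-- `|p(t)|·e^{−t} ≤ Σ_{m ≤ d} |[X^m]p|·m!` for `deg p ≤ d` and `t ≥ 0`. [cite: DisertoriRivasseau2000, §II.2 (II.14) footnote p0004:L18–26] -/
theorem abs_eval_mul_exp_neg_le_sum_abs_coeff (p : ℝ[X]) {d : ℕ} (hd : p.natDegree ≤ d) {t : ℝ} (ht : 0 ≤ t) :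
    |p.eval t| * exp (-t) ≤ ∑ m ∈ range (d + 1), |p.coeff m| * (m ! : ℝ) := by
  rw [eval_eq_sum_range' (Nat.lt_succ_of_le hd)]
  calc |∑ m ∈ range (d + 1), p.coeff m * t ^ m| * exp (-t)
        ≤ (∑ m ∈ range (d + 1), |p.coeff m * t ^ m|) * exp (-t) := by
          gcongr; exact abs_sum_le_sum_abs _ _
    _ = ∑ m ∈ range (d + 1), |p.coeff m| * (t ^ m * exp (-t)) := by
          rw [sum_mul]; refine sum_congr rfl fun m _ => ?_
          rw [abs_mul, abs_of_nonneg (pow_nonneg ht m)]; ring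
    _ ≤ ∑ m ∈ range (d + 1), |p.coeff m| * (m ! : ℝ) :=
          sum_le_sum fun m _ => mul_le_mul_of_nonneg_left (pow_mul_exp_neg_le_factorial ht m) (abs_nonneg _)

/-- `(m+2)! + m·(m+1)! = 2(m+1)²·m!`. [cite: DisertoriRivasseau2000, §II.2 (II.14) footnote p0004:L18–26] -/
theorem factorial_add_two_add_mul_factorial_succ (m : ℕ) :
    (((m + 2) ! : ℕ) : ℝ) + (m : ℝ) * (((m + 1) ! : ℕ) : ℝ) = 2 * ((m : ℝ) + 1) ^ 2 * (m ! : ℝ) := by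
  rw [Nat.factorial_succ (m + 1), Nat.factorial_succ m]
  push_cast
  ring

/-- **The mass step**: for `deg p ≤ d`, `Σ_{m ≤ d+2} |[X^m](X²(p − p′))|·m! ≤ 2(d+1)²·Σ_{m ≤ d} |[X^m]p|·m!`
(`[X^{i+2}](X²(p − p′)) = [X^i]p − (i+1)[X^{i+1}]p`, `(m+2)! + m(m+1)! = 2(m+1)²m!`). [cite: DisertoriRivasseau2000, §II.2 (II.14) footnote p0004:L18–26] -/
theorem sum_abs_coeff_X_sq_mul_sub_derivative_le (p : ℝ[X]) {d : ℕ} (hd : p.natDegree ≤ d) :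
    ∑ m ∈ range (d + 3), |(X ^ 2 * (p - derivative p)).coeff m| * (m ! : ℝ) ≤
      2 * ((d : ℝ) + 1) ^ 2 * ∑ m ∈ range (d + 1), |p.coeff m| * (m ! : ℝ) := by
  set q : ℝ[X] := X ^ 2 * (p - derivative p) with hq
  -- the coefficients of `q`
  have hq0 : q.coeff 0 = 0 := by rw [hq, coeff_X_pow_mul']; simp
  have hq1 : q.coeff 1 = 0 := by rw [hq, coeff_X_pow_mul']; simp
  have hq2 : ∀ i, q.coeff (i + 2) = p.coeff i - p.coeff (i + 1) * ((i : ℝ) + 1) := by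
    intro i
    rw [hq, coeff_X_pow_mul, coeff_sub, coeff_derivative]
  -- the top coefficient of `p` beyond `d` vanishes
  have htop : p.coeff (d + 1) = 0 := coeff_eq_zero_of_natDegree_lt (Nat.lt_succ_of_le hd)
  -- peel off `m = 0, 1`
  rw [sum_range_succ' _ (d + 2), sum_range_succ' _ (d + 1), hq0, hq1]
  simp only [abs_zero, zero_mul, add_zero]
  -- termwise triangle inequality
  have hterm : ∀ i ∈ range (d + 1), |q.coeff (i + 1 + 1)| * (((i + 1 + 1) ! : ℕ) : ℝ) ≤
      |p.coeff i| * (((i + 2) ! : ℕ) : ℝ) + |p.coeff (i + 1)| * ((i : ℝ) + 1) * (((i + 2) ! : ℕ) : ℝ) := by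
    intro i _
    rw [show i + 1 + 1 = i + 2 by ring, hq2 i]
    have h1 : |p.coeff i - p.coeff (i + 1) * ((i : ℝ) + 1)| ≤ |p.coeff i| + |p.coeff (i + 1)| * ((i : ℝ) + 1) := by
      refine (abs_sub _ _).trans (le_of_eq ?_)
      rw [abs_mul, abs_of_nonneg (by positivity : (0 : ℝ) ≤ (i : ℝ) + 1)]
    calc |p.coeff i - p.coeff (i + 1) * ((i : ℝ) + 1)| * (((i + 2) ! : ℕ) : ℝ)
        ≤ (|p.coeff i| + |p.coeff (i + 1)| * ((i : ℝ) + 1)) * (((i + 2) ! : ℕ) : ℝ) := by gcongr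
      _ = _ := by ring
  refine (sum_le_sum hterm).trans ?_
  rw [sum_add_distrib]
  -- reindex the second sum: `Σ_{i<d+1} |a_{i+1}|(i+1)(i+2)! = Σ_{m<d+1} |a_m|·m·(m+1)!` (the `m = 0` term is `0`, the `m = d+1` term is `0`)
  have hshift : ∑ i ∈ range (d + 1), |p.coeff (i + 1)| * ((i : ℝ) + 1) * (((i + 2) ! : ℕ) : ℝ) =
      ∑ m ∈ range (d + 1), |p.coeff m| * (m : ℝ) * (((m + 1) ! : ℕ) : ℝ) := by
    have e1 : ∑ m ∈ range (d + 1 + 1), |p.coeff m| * (m : ℝ) * (((m + 1) ! : ℕ) : ℝ) =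
        ∑ i ∈ range (d + 1), |p.coeff (i + 1)| * ((i : ℝ) + 1) * (((i + 2) ! : ℕ) : ℝ) := by
      rw [sum_range_succ']
      simp only [Nat.cast_zero, mul_zero, zero_mul, add_zero, Nat.cast_succ]
    have e2 : ∑ m ∈ range (d + 1 + 1), |p.coeff m| * (m : ℝ) * (((m + 1) ! : ℕ) : ℝ) =
        ∑ m ∈ range (d + 1), |p.coeff m| * (m : ℝ) * (((m + 1) ! : ℕ) : ℝ) := by
      rw [sum_range_succ, htop, abs_zero, zero_mul, zero_mul, add_zero]
    rw [← e1, e2]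
  rw [hshift, ← sum_add_distrib, mul_sum]
  refine sum_le_sum fun m hm => ?_
  have hmd : (m : ℝ) ≤ d := by exact_mod_cast Nat.lt_succ_iff.1 (mem_range.1 hm)
  have hid : |p.coeff m| * (((m + 2) ! : ℕ) : ℝ) + |p.coeff m| * (m : ℝ) * (((m + 1) ! : ℕ) : ℝ) =
      |p.coeff m| * (2 * ((m : ℝ) + 1) ^ 2 * (m ! : ℝ)) := by
    rw [← factorial_add_two_add_mul_factorial_succ m]; ring
  rw [hid]
  have h0 : 0 ≤ |p.coeff m| * (m ! : ℝ) := by positivity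
  calc |p.coeff m| * (2 * ((m : ℝ) + 1) ^ 2 * (m ! : ℝ)) = 2 * ((m : ℝ) + 1) ^ 2 * (|p.coeff m| * (m ! : ℝ)) := by ring
    _ ≤ 2 * ((d : ℝ) + 1) ^ 2 * (|p.coeff m| * (m ! : ℝ)) := by gcongr

/-! ## §2 `expNegInvGlue`: the polynomial structure of the derivatives and the Gevrey-2 bound -/

/-- **Structure of the derivatives of `expNegInvGlue`**: for every `n` there is `P_n ∈ ℝ[X]` with `deg P_n ≤ 2n`,
`expNegInvGlue^{(n)}(x) = P_n(x⁻¹)·expNegInvGlue(x)` for ALL `x` (`P₀ = 1`, `P_{n+1} = X²(P_n − P_n′)`, Mathlib's recursion), and weighted coefficient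
mass `Σ_{m ≤ 2n} |[X^m]P_n|·m! ≤ 8ⁿ·(n!)²`. [cite: DisertoriRivasseau2000, §II.2 (II.14) footnote p0004:L18–26] -/
theorem exists_poly_iteratedDeriv_expNegInvGlue (n : ℕ) :
    ∃ p : ℝ[X], p.natDegree ≤ 2 * n ∧
      (iteratedDeriv n expNegInvGlue = fun x => p.eval x⁻¹ * expNegInvGlue x) ∧
      ∑ m ∈ range (2 * n + 1), |p.coeff m| * (m ! : ℝ) ≤ 8 ^ n * ((n ! : ℝ)) ^ 2 := by
  induction n with
  | zero =>
    refine ⟨1, by simp, ?_, ?_⟩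
    · funext x; simp
    · simp
  | succ n ih =>
    obtain ⟨p, hdeg, hder, hmass⟩ := ih
    refine ⟨X ^ 2 * (p - derivative p), ?_, ?_, ?_⟩
    · have h1 : (X ^ 2 : ℝ[X]).natDegree ≤ 2 := natDegree_pow_le_of_le 2 natDegree_X_le
      have h2 : (p - derivative p).natDegree ≤ 2 * n :=
        (natDegree_sub_le _ _).trans (max_le hdeg ((natDegree_derivative_le p).trans ((Nat.sub_le _ _).trans hdeg)))
      calc (X ^ 2 * (p - derivative p)).natDegree ≤ (X ^ 2 : ℝ[X]).natDegree + (p - derivative p).natDegree := natDegree_mul_le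
        _ ≤ 2 + 2 * n := add_le_add h1 h2
        _ = 2 * (n + 1) := by ring
    · rw [iteratedDeriv_succ, hder]
      funext x
      exact (expNegInvGlue.hasDerivAt_polynomial_eval_inv_mul p x).deriv
    · rw [show 2 * (n + 1) + 1 = 2 * n + 3 by ring]
      refine (sum_abs_coeff_X_sq_mul_sub_derivative_le p hdeg).trans ?_
      have h8 : 2 * (((2 * n : ℕ) : ℝ) + 1) ^ 2 ≤ 8 * ((n : ℝ) + 1) ^ 2 := by
        have hn : (0 : ℝ) ≤ n := Nat.cast_nonneg n
        push_cast; nlinarith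
      have h0 : 0 ≤ ∑ m ∈ range (2 * n + 1), |p.coeff m| * (m ! : ℝ) := sum_nonneg fun m _ => by positivity
      calc 2 * (((2 * n : ℕ) : ℝ) + 1) ^ 2 * ∑ m ∈ range (2 * n + 1), |p.coeff m| * (m ! : ℝ)
          ≤ 8 * ((n : ℝ) + 1) ^ 2 * (8 ^ n * ((n ! : ℝ)) ^ 2) := by gcongr
        _ = 8 ^ (n + 1) * (((n + 1) ! : ℕ) : ℝ) ^ 2 := by rw [Nat.factorial_succ]; push_cast; ring

/-- **GEVREY-2 BOUND FOR `expNegInvGlue`**: `|expNegInvGlue^{(n)}(x)| ≤ 8ⁿ·(n!)²` for every `n` and every `x`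
(`x ≤ 0`: the derivative is `P_n(x⁻¹)·0`; `x > 0`: `|P_n(t)|e^{−t} ≤ Σ|[X^m]P_n|·m!`, `t = x⁻¹`). [cite: DisertoriRivasseau2000, §II.2 (II.14) footnote p0004:L18–26] -/
theorem abs_iteratedDeriv_expNegInvGlue_le (n : ℕ) (x : ℝ) : |iteratedDeriv n expNegInvGlue x| ≤ 8 ^ n * ((n ! : ℝ)) ^ 2 := by
  obtain ⟨p, hdeg, hder, hmass⟩ := exists_poly_iteratedDeriv_expNegInvGlue n
  rw [hder]
  dsimp only
  rcases le_or_gt x 0 with hx | hx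
  · rw [expNegInvGlue.zero_of_nonpos hx, mul_zero, abs_zero]; positivity
  · have hE : expNegInvGlue x = exp (-x⁻¹) := by simp [expNegInvGlue, not_le.2 hx]
    rw [hE, abs_mul, abs_of_pos (exp_pos _)]
    exact (abs_eval_mul_exp_neg_le_sum_abs_coeff p hdeg (inv_nonneg.2 hx.le)).trans hmass

/-- The same in Fréchet form: `‖iteratedFDeriv ℝ n expNegInvGlue x‖ ≤ 8ⁿ·(n!)²`. [cite: DisertoriRivasseau2000, §II.2 (II.14) footnote p0004:L18–26] -/
theorem norm_iteratedFDeriv_expNegInvGlue_le (n : ℕ) (x : ℝ) : ‖iteratedFDeriv ℝ n expNegInvGlue x‖ ≤ 8 ^ n * ((n ! : ℝ)) ^ 2 := by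
  rw [norm_iteratedFDeriv_eq_norm_iteratedDeriv, Real.norm_eq_abs]
  exact abs_iteratedDeriv_expNegInvGlue_le n x

/-! ## §3 The Gevrey-2 reciprocal rule and Leibniz (one variable, at a point) -/

/-- `(r − σ)·Σ_{i ≤ j} σⁱ·r^{j−i} = r^{j+1} − σ^{j+1}`. [cite: DisertoriRivasseau2000, §II.2 (II.14) footnote p0004:L18–26] -/
theorem sub_mul_sum_pow_mul_pow_eq (r σ : ℝ) (j : ℕ) :
    (r - σ) * ∑ i ∈ range (j + 1), σ ^ i * r ^ (j - i) = r ^ (j + 1) - σ ^ (j + 1) := by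
  induction j with
  | zero => simp
  | succ j ih =>
    have hsplit : ∑ i ∈ range (j + 2), σ ^ i * r ^ (j + 1 - i) = r * ∑ i ∈ range (j + 1), σ ^ i * r ^ (j - i) + σ ^ (j + 1) := by
      rw [sum_range_succ, Nat.sub_self, pow_zero, mul_one, mul_sum]
      congr 1
      refine sum_congr rfl fun i hi => ?_
      have hij : i ≤ j := Nat.lt_succ_iff.1 (mem_range.1 hi)
      rw [show j + 1 - i = (j - i) + 1 by omega, pow_succ]
      ring
    rw [hsplit, mul_add, ← mul_assoc, mul_comm (r - σ) r, mul_assoc, ih]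
    ring

/-- **GEVREY-2 RECIPROCAL RULE** (one variable, at a point): if `f` is smooth, `|f(x)| ≥ d > 0` and `|f^{(i)}(x)| ≤ B·(i!)²·σⁱ` for `1 ≤ i ≤ n`,
then `|(1/f)^{(n)}(x)| ≤ d⁻¹·(n!)²·(σ(1 + B/d))ⁿ` (Leibniz on `f·(1/f) = 1`, induction, `C(j,i)·i!·(j−i)! = j!`, `i!(j−i)! ≤ j!`,
and `(B/d)·σ·Σ_{i ≤ j} σⁱr^{j−i} = r^{j+1} − σ^{j+1}` for `r = σ(1+B/d)`). [cite: DisertoriRivasseau2000, §II.2 (II.14) footnote p0004:L18–26] -/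
theorem abs_iteratedDeriv_inv_le_of_gevrey_two {f : ℝ → ℝ} (hf : ContDiff ℝ (⊤ : ℕ∞) f) {x d B σ : ℝ}
    (hd : 0 < d) (hB : 0 ≤ B) (hσ : 0 ≤ σ) (hfx : d ≤ |f x|) (n : ℕ)
    (hDf : ∀ i, 1 ≤ i → i ≤ n → |iteratedDeriv i f x| ≤ B * ((i ! : ℝ)) ^ 2 * σ ^ i) :
    |iteratedDeriv n (fun y => (f y)⁻¹) x| ≤ d⁻¹ * ((n ! : ℝ)) ^ 2 * (σ * (1 + B / d)) ^ n := by
  set r : ℝ := σ * (1 + B / d) with hr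
  have hr0 : 0 ≤ r := by positivity
  have hfx0 : f x ≠ 0 := fun h => by rw [h, abs_zero] at hfx; exact absurd hfx (not_le.2 hd)
  have hfxpos : 0 < |f x| := hd.trans_le hfx
  set g : ℝ → ℝ := fun y => (f y)⁻¹ with hg
  have hN : ∀ j : ℕ, ((j : ℕ∞) : WithTop ℕ∞) ≤ ((⊤ : ℕ∞) : WithTop ℕ∞) := fun j => by exact_mod_cast le_top
  have hfC : ∀ j : ℕ, ContDiffAt ℝ j f x := fun j => hf.contDiffAt.of_le (hN j)
  have hgC : ∀ j : ℕ, ContDiffAt ℝ j g x := fun j => (hfC j).inv hfx0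
  -- Leibniz on `f · g = 1` near `x`
  have hleib : ∀ j, 1 ≤ j → ∑ i ∈ range (j + 1), (j.choose i : ℝ) * iteratedDeriv i f x * iteratedDeriv (j - i) g x = 0 := by
    intro j hj
    have hev : (fun y => f y * g y) =ᶠ[𝓝 x] fun _ => (1 : ℝ) := by
      filter_upwards [hf.continuous.continuousAt.eventually_ne hfx0] with y hy
      simp [g, mul_inv_cancel₀ hy]
    have hprod : iteratedDeriv j (fun y => f y * g y) x = 0 := by
      rw [hev.iteratedDeriv_eq, iteratedDeriv_const, if_neg (by omega)]
    rw [← hprod, iteratedDeriv_fun_mul (hfC j) (hgC j)]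
  -- the claim for all `j ≤ n`, by strong induction
  suffices hmain : ∀ j ≤ n, |iteratedDeriv j g x| ≤ d⁻¹ * ((j ! : ℝ)) ^ 2 * r ^ j from hmain n le_rfl
  intro j
  induction j using Nat.strong_induction_on with
  | _ j ih =>
    intro hjn
    rcases j with _ | j
    · simp only [iteratedDeriv_zero, g, Nat.factorial_zero, Nat.cast_one, one_pow, mul_one, pow_zero, abs_inv]
      exact inv_anti₀ hd hfx
    · -- isolate the `i = 0` term `f(x)·g^{(j+1)}(x)`
      have h := hleib (j + 1) (by omega)
      rw [sum_range_succ'] at h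
      simp only [Nat.choose_zero_right, Nat.cast_one, one_mul, iteratedDeriv_zero, Nat.sub_zero] at h
      -- `f x · g^{(j+1)} x = −Σ_{i<j+1} C(j+1,i+1) f^{(i+1)} g^{(j−i)}`
      have hsolve : iteratedDeriv (j + 1) g x =
          -(∑ i ∈ range (j + 1), ((j + 1).choose (i + 1) : ℝ) * iteratedDeriv (i + 1) f x * iteratedDeriv (j + 1 - (i + 1)) g x) / f x := by
        field_simp
        linarith
      -- bound each term
      have hterm : ∀ i ∈ range (j + 1), |((j + 1).choose (i + 1) : ℝ) * iteratedDeriv (i + 1) f x * iteratedDeriv (j + 1 - (i + 1)) g x| ≤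
          B * d⁻¹ * (((j + 1) ! : ℕ) : ℝ) ^ 2 * (σ ^ (i + 1) * r ^ (j - i)) := by
        intro i hi
        have hij : i ≤ j := Nat.lt_succ_iff.1 (mem_range.1 hi)
        rw [show j + 1 - (i + 1) = j - i by omega, abs_mul, abs_mul, Nat.abs_cast]
        have hf' := hDf (i + 1) (by omega) (by omega)
        have hg' := ih (j - i) (by omega) (by omega)
        -- `C(j+1,i+1)·((i+1)!)²·((j−i)!)² ≤ ((j+1)!)²`
        have hchoose : ((j + 1).choose (i + 1) : ℝ) * ((((i + 1) ! : ℕ) : ℝ) ^ 2 * ((((j - i) ! : ℕ) : ℝ)) ^ 2) ≤ (((j + 1) ! : ℕ) : ℝ) ^ 2 := by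
          have h1 : ((j + 1).choose (i + 1) : ℝ) * (((i + 1) ! : ℕ) : ℝ) * ((((j - i) ! : ℕ) : ℝ)) = (((j + 1) ! : ℕ) : ℝ) := by
            have := Nat.choose_mul_factorial_mul_factorial (show i + 1 ≤ j + 1 by omega)
            rw [show j + 1 - (i + 1) = j - i by omega] at this
            exact_mod_cast this
          have h2 : (((i + 1) ! : ℕ) : ℝ) * ((((j - i) ! : ℕ) : ℝ)) ≤ (((j + 1) ! : ℕ) : ℝ) := by
            have := Nat.le_of_dvd (Nat.factorial_pos _) (Nat.factorial_mul_factorial_dvd_factorial_add (i + 1) (j - i))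
            rw [show i + 1 + (j - i) = j + 1 by omega] at this
            exact_mod_cast this
          calc ((j + 1).choose (i + 1) : ℝ) * ((((i + 1) ! : ℕ) : ℝ) ^ 2 * ((((j - i) ! : ℕ) : ℝ)) ^ 2)
              = (((j + 1).choose (i + 1) : ℝ) * (((i + 1) ! : ℕ) : ℝ) * ((((j - i) ! : ℕ) : ℝ))) *
                  ((((i + 1) ! : ℕ) : ℝ) * ((((j - i) ! : ℕ) : ℝ))) := by ring
            _ ≤ (((j + 1) ! : ℕ) : ℝ) * (((j + 1) ! : ℕ) : ℝ) := by rw [h1]; gcongr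
            _ = (((j + 1) ! : ℕ) : ℝ) ^ 2 := by ring
        calc ((j + 1).choose (i + 1) : ℝ) * |iteratedDeriv (i + 1) f x| * |iteratedDeriv (j - i) g x|
            ≤ ((j + 1).choose (i + 1) : ℝ) * (B * ((((i + 1) ! : ℕ) : ℝ)) ^ 2 * σ ^ (i + 1)) * (d⁻¹ * ((((j - i) ! : ℕ) : ℝ)) ^ 2 * r ^ (j - i)) := by
              gcongr
          _ = B * d⁻¹ * (((j + 1).choose (i + 1) : ℝ) * ((((i + 1) ! : ℕ) : ℝ) ^ 2 * ((((j - i) ! : ℕ) : ℝ)) ^ 2)) * (σ ^ (i + 1) * r ^ (j - i)) := by ring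
          _ ≤ B * d⁻¹ * (((j + 1) ! : ℕ) : ℝ) ^ 2 * (σ ^ (i + 1) * r ^ (j - i)) := by gcongr
      -- sum the bounds: `(B/d)·Σ σ^{i+1} r^{j−i} = d⁻¹·(r^{j+1} − σ^{j+1})`
      have hsum : ∑ i ∈ range (j + 1), σ ^ (i + 1) * r ^ (j - i) = σ * ∑ i ∈ range (j + 1), σ ^ i * r ^ (j - i) := by
        rw [mul_sum]; refine sum_congr rfl fun i _ => ?_; rw [pow_succ]; ring
      have htel : B * d⁻¹ * (σ * ∑ i ∈ range (j + 1), σ ^ i * r ^ (j - i)) = r ^ (j + 1) - σ ^ (j + 1) := by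
        rw [← sub_mul_sum_pow_mul_pow_eq r σ j, hr]
        field_simp
        ring
      calc |iteratedDeriv (j + 1) g x|
          = |∑ i ∈ range (j + 1), ((j + 1).choose (i + 1) : ℝ) * iteratedDeriv (i + 1) f x * iteratedDeriv (j + 1 - (i + 1)) g x| / |f x| := by
            rw [hsolve, abs_div, abs_neg]
        _ ≤ (∑ i ∈ range (j + 1), B * d⁻¹ * (((j + 1) ! : ℕ) : ℝ) ^ 2 * (σ ^ (i + 1) * r ^ (j - i))) / d := by
            gcongr
            exact (abs_sum_le_sum_abs _ _).trans (sum_le_sum hterm)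
        _ = d⁻¹ * (((j + 1) ! : ℕ) : ℝ) ^ 2 * (B * d⁻¹ * (σ * ∑ i ∈ range (j + 1), σ ^ i * r ^ (j - i))) := by
            rw [← mul_sum, hsum]; field_simp
        _ = d⁻¹ * (((j + 1) ! : ℕ) : ℝ) ^ 2 * (r ^ (j + 1) - σ ^ (j + 1)) := by rw [htel]
        _ ≤ d⁻¹ * (((j + 1) ! : ℕ) : ℝ) ^ 2 * r ^ (j + 1) := by
            gcongr
            exact sub_le_self _ (pow_nonneg hσ _)

/-- **Leibniz for two `(n!)²`-geometric jets with a common ratio** (one variable, at a point): `|f^{(i)}| ≤ A(i!)²ρⁱ`, `|g^{(i)}| ≤ B(i!)²ρⁱ` for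
`i ≤ n` ⇒ `|(fg)^{(n)}| ≤ A·B·(n!)²·(2ρ)ⁿ` (`Σ_i C(n,i) = 2ⁿ`, `C(n,i)(i!)²((n−i)!)² ≤ (n!)²`). [cite: DisertoriRivasseau2000, §II.2 (II.14) footnote p0004:L18–26] -/
theorem abs_iteratedDeriv_mul_le_of_sq_factorial {f g : ℝ → ℝ} (hf : ContDiff ℝ (⊤ : ℕ∞) f) (hg : ContDiff ℝ (⊤ : ℕ∞) g) (x : ℝ) {A B ρ : ℝ}
    (hA : 0 ≤ A) (hB : 0 ≤ B) (hρ : 0 ≤ ρ) (n : ℕ)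
    (hfA : ∀ i ≤ n, |iteratedDeriv i f x| ≤ A * ((i ! : ℝ)) ^ 2 * ρ ^ i) (hgB : ∀ i ≤ n, |iteratedDeriv i g x| ≤ B * ((i ! : ℝ)) ^ 2 * ρ ^ i) :
    |iteratedDeriv n (fun y => f y * g y) x| ≤ A * B * ((n ! : ℝ)) ^ 2 * (2 * ρ) ^ n := by
  have hN : ((n : ℕ∞) : WithTop ℕ∞) ≤ ((⊤ : ℕ∞) : WithTop ℕ∞) := by exact_mod_cast le_top
  rw [iteratedDeriv_fun_mul (hf.contDiffAt.of_le hN) (hg.contDiffAt.of_le hN)]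
  have hterm : ∀ i ∈ range (n + 1), |(n.choose i : ℝ) * iteratedDeriv i f x * iteratedDeriv (n - i) g x| ≤
      A * B * ((n ! : ℝ)) ^ 2 * ρ ^ n * (n.choose i : ℝ) := by
    intro i hi
    have hin : i ≤ n := Nat.lt_succ_iff.1 (mem_range.1 hi)
    rw [abs_mul, abs_mul, Nat.abs_cast]
    have h2 : ((i ! : ℕ) : ℝ) * ((((n - i) ! : ℕ) : ℝ)) ≤ ((n ! : ℕ) : ℝ) := by
      have := Nat.le_of_dvd (Nat.factorial_pos _) (Nat.factorial_mul_factorial_dvd_factorial_add i (n - i))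
      rw [Nat.add_sub_cancel' hin] at this
      exact_mod_cast this
    have hpow : ρ ^ i * ρ ^ (n - i) = ρ ^ n := by rw [← pow_add, Nat.add_sub_cancel' hin]
    calc (n.choose i : ℝ) * |iteratedDeriv i f x| * |iteratedDeriv (n - i) g x|
        ≤ (n.choose i : ℝ) * (A * ((i ! : ℝ)) ^ 2 * ρ ^ i) * (B * ((((n - i) ! : ℕ) : ℝ)) ^ 2 * ρ ^ (n - i)) := by
          gcongr
          · exact hfA i hin
          · exact hgB (n - i) (Nat.sub_le _ _)
      _ = A * B * (((i ! : ℕ) : ℝ) * (((n - i) ! : ℕ) : ℝ)) ^ 2 * (ρ ^ i * ρ ^ (n - i)) * (n.choose i : ℝ) := by ring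
      _ ≤ A * B * ((n ! : ℝ)) ^ 2 * ρ ^ n * (n.choose i : ℝ) := by rw [hpow]; gcongr
  calc |∑ i ∈ range (n + 1), (n.choose i : ℝ) * iteratedDeriv i f x * iteratedDeriv (n - i) g x|
      ≤ ∑ i ∈ range (n + 1), A * B * ((n ! : ℝ)) ^ 2 * ρ ^ n * (n.choose i : ℝ) := (abs_sum_le_sum_abs _ _).trans (sum_le_sum hterm)
    _ = A * B * ((n ! : ℝ)) ^ 2 * ρ ^ n * ∑ i ∈ range (n + 1), (n.choose i : ℝ) := by rw [mul_sum]
    _ = A * B * ((n ! : ℝ)) ^ 2 * (2 * ρ) ^ n := by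
        rw [mul_pow, ← Nat.cast_sum, Nat.sum_range_choose]; push_cast; ring

/-! ## §4 `Real.smoothTransition = E/(E + E(1−·))` -/

/-- The denominator of `smoothTransition` is bounded below: `e^{−2} ≤ expNegInvGlue x + expNegInvGlue (1 − x)` (one of `x`, `1 − x` is `≥ ½`,
and `expNegInvGlue ½ = e^{−2}`). [cite: DisertoriRivasseau2000, §II.2 (II.14) footnote p0004:L18–26] -/
theorem exp_neg_two_le_expNegInvGlue_add (x : ℝ) : exp (-2) ≤ expNegInvGlue x + expNegInvGlue (1 - x) := by
  have hhalf : expNegInvGlue (1 / 2) = exp (-2) := by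
    simp only [expNegInvGlue, one_div, inv_inv]
    rw [if_neg (by norm_num)]
  rcases le_or_gt (1 / 2 : ℝ) x with hx | hx
  · have h1 : exp (-2) ≤ expNegInvGlue x := hhalf ▸ expNegInvGlue.monotone hx
    linarith [expNegInvGlue.nonneg (1 - x)]
  · have h1 : exp (-2) ≤ expNegInvGlue (1 - x) := hhalf ▸ expNegInvGlue.monotone (by linarith)
    linarith [expNegInvGlue.nonneg x]

/-- The denominator is smooth. [cite: DisertoriRivasseau2000, §II.2 (II.14) footnote p0004:L18–26] -/
theorem contDiff_expNegInvGlue_add {n : ℕ∞} : ContDiff ℝ n (fun x => expNegInvGlue x + expNegInvGlue (1 - x)) :=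
  expNegInvGlue.contDiff.add (expNegInvGlue.contDiff.comp (contDiff_const.sub contDiff_id))

/-- Jets of the denominator: `|(E + E(1−·))^{(n)}(x)| ≤ 2·8ⁿ·(n!)²` (`(E(1−·))^{(n)}(x) = (−1)ⁿE^{(n)}(1−x)`). [cite: DisertoriRivasseau2000, §II.2 (II.14) footnote p0004:L18–26] -/
theorem abs_iteratedDeriv_expNegInvGlue_add_le (n : ℕ) (x : ℝ) :
    |iteratedDeriv n (fun x => expNegInvGlue x + expNegInvGlue (1 - x)) x| ≤ 2 * (8 ^ n * ((n ! : ℝ)) ^ 2) := by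
  have hN : ((n : ℕ∞) : WithTop ℕ∞) ≤ ((⊤ : ℕ∞) : WithTop ℕ∞) := by exact_mod_cast le_top
  have h1 : ContDiffAt ℝ n expNegInvGlue x := expNegInvGlue.contDiff.contDiffAt.of_le hN
  have h2 : ContDiffAt ℝ n (fun x => expNegInvGlue (1 - x)) x :=
    (expNegInvGlue.contDiff.comp (contDiff_const.sub contDiff_id)).contDiffAt.of_le hN
  rw [iteratedDeriv_fun_add h1 h2, iteratedDeriv_comp_const_sub n expNegInvGlue 1]
  dsimp only
  refine (abs_add_le _ _).trans ?_
  rw [two_mul]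
  refine add_le_add (abs_iteratedDeriv_expNegInvGlue_le n x) ?_
  rw [smul_eq_mul, abs_mul, abs_pow, abs_neg, abs_one, one_pow, one_mul]
  exact abs_iteratedDeriv_expNegInvGlue_le n (1 - x)

/-- Jets of the reciprocal of the denominator: `|(1/(E + E(1−·)))^{(n)}(x)| ≤ e²·(n!)²·(8(1 + 2e²))ⁿ` (the reciprocal rule with `d = e^{−2}`,
`B = 2`, `σ = 8`). [cite: DisertoriRivasseau2000, §II.2 (II.14) footnote p0004:L18–26] -/
theorem abs_iteratedDeriv_inv_expNegInvGlue_add_le (n : ℕ) (x : ℝ) :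
    |iteratedDeriv n (fun y => (expNegInvGlue y + expNegInvGlue (1 - y))⁻¹) x| ≤ exp 2 * ((n ! : ℝ)) ^ 2 * (8 * (1 + 2 * exp 2)) ^ n := by
  have hd : 0 < exp (-2) := exp_pos _
  have h := abs_iteratedDeriv_inv_le_of_gevrey_two (f := fun y => expNegInvGlue y + expNegInvGlue (1 - y)) contDiff_expNegInvGlue_add
    (x := x) (d := exp (-2)) (B := 2) (σ := 8) hd (by norm_num) (by norm_num)
    ((exp_neg_two_le_expNegInvGlue_add x).trans (le_abs_self _)) n
    (fun i _ _ => by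
      have h := abs_iteratedDeriv_expNegInvGlue_add_le i x
      linarith [h])
  have hinv : (exp (-2))⁻¹ = exp 2 := by rw [Real.exp_neg, inv_inv]
  have hdiv : (2 : ℝ) / exp (-2) = 2 * exp 2 := by rw [div_eq_mul_inv, hinv]
  rw [hinv, hdiv] at h
  exact h

/-- **GEVREY-2 BOUND FOR `Real.smoothTransition`**: `|smoothTransition^{(n)}(x)| ≤ e²·(n!)²·(16(1+2e²))ⁿ` for every `n` and every `x`
(`smoothTransition = E · (E + E(1−·))⁻¹`, Leibniz with the common ratio `8(1+2e²) ≥ 8`). [cite: DisertoriRivasseau2000, §II.2 (II.14) footnote p0004:L18–26] -/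
theorem abs_iteratedDeriv_smoothTransition_le (n : ℕ) (x : ℝ) :
    |iteratedDeriv n Real.smoothTransition x| ≤ exp 2 * ((n ! : ℝ)) ^ 2 * (16 * (1 + 2 * exp 2)) ^ n := by
  have hfun : Real.smoothTransition = fun y => expNegInvGlue y * (expNegInvGlue y + expNegInvGlue (1 - y))⁻¹ := by
    funext y; rw [Real.smoothTransition, div_eq_mul_inv]
  rw [hfun]
  have hρ8 : (8 : ℝ) ≤ 8 * (1 + 2 * exp 2) := by nlinarith [exp_pos (2 : ℝ)]
  have hinvC : ContDiff ℝ (⊤ : ℕ∞) (fun y => (expNegInvGlue y + expNegInvGlue (1 - y))⁻¹) :=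
    contDiff_expNegInvGlue_add.inv fun y => (Real.smoothTransition.pos_denom y).ne'
  have h := abs_iteratedDeriv_mul_le_of_sq_factorial expNegInvGlue.contDiff hinvC x (A := 1) (B := exp 2) (ρ := 8 * (1 + 2 * exp 2))
    zero_le_one (exp_pos _).le (by positivity) n
    (fun i _ => by
      rw [one_mul]
      exact (abs_iteratedDeriv_expNegInvGlue_le i x).trans (by
        rw [mul_comm]
        exact mul_le_mul_of_nonneg_left (pow_le_pow_left₀ (by norm_num) hρ8 i) (by positivity)))
    (fun i _ => abs_iteratedDeriv_inv_expNegInvGlue_add_le i x)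
  refine h.trans (le_of_eq ?_)
  ring

/-- **Numeral form**: `|smoothTransition^{(n)}(x)| ≤ 8·(n!)²·256ⁿ` (`e² < 7.5`, `16(1 + 2e²) < 256`). [cite: DisertoriRivasseau2000, §II.2 (II.14) footnote p0004:L18–26] -/
theorem abs_iteratedDeriv_smoothTransition_le_numeral (n : ℕ) (x : ℝ) :
    |iteratedDeriv n Real.smoothTransition x| ≤ 8 * ((n ! : ℝ)) ^ 2 * 256 ^ n := by
  have he : exp 2 < 7.5 := by
    have h1 := Real.exp_one_lt_d9
    have h2 : exp (2 : ℝ) = exp 1 * exp 1 := by rw [← Real.exp_add]; norm_num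
    rw [h2]; nlinarith [exp_pos (1 : ℝ)]
  have hρ : 16 * (1 + 2 * exp 2) ≤ (256 : ℝ) := by linarith
  calc |iteratedDeriv n Real.smoothTransition x| ≤ exp 2 * ((n ! : ℝ)) ^ 2 * (16 * (1 + 2 * exp 2)) ^ n :=
        abs_iteratedDeriv_smoothTransition_le n x
    _ ≤ 8 * ((n ! : ℝ)) ^ 2 * 256 ^ n := by
        have h8 : exp 2 ≤ 8 := by linarith
        gcongr

/-- Fréchet form of the numeral bound: `‖iteratedFDeriv ℝ n smoothTransition x‖ ≤ 8·(n!)²·256ⁿ`. [cite: DisertoriRivasseau2000, §II.2 (II.14) footnote p0004:L18–26] -/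
theorem norm_iteratedFDeriv_smoothTransition_le_numeral (n : ℕ) (x : ℝ) :
    ‖iteratedFDeriv ℝ n Real.smoothTransition x‖ ≤ 8 * ((n ! : ℝ)) ^ 2 * 256 ^ n := by
  rw [norm_iteratedFDeriv_eq_norm_iteratedDeriv, Real.norm_eq_abs]
  exact abs_iteratedDeriv_smoothTransition_le_numeral n x

end Literature.Analysis.Calculus

end
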